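import Summits.Ventures.MM22.Rank333.WangTop333Checks17
import Summits.Ventures.MM22.Rank333.WangTop333Checks18
import Summits.Ventures.MM22.Rank333.WangTop333Checks19
import Summits.Ventures.MM22.Rank333.WangTop333Checks20
import Summits.Ventures.MM22.Rank333.LowerBounds
import HarnessLib

/-!
# MM22 venture, Route D3 — Wang's `⟨3,3,3⟩` certificate over `𝔽₂`, top layers: the CONDITIONAL theorem

HONEST FRAMING (cell `pub-mm22`, seat p3, Route D3). Kernel replay (`decide +kernel`, axioms standard) of the TOP
LAYERS of Wang's certificate for `20 ≤ R_{𝔽₂}(⟨3,3,3⟩)` (arXiv:2603.07280, `cert_matrix_q02_n333`): the unconstrained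
orbit (bound 20, 511 DFS leaves) and the codimension-1 orbits `[1]`, `[10]`, `[84]` (bound 19; 396 + 255 + 255 leaves),
each justified by one lookup and one DFS round whose every leaf is looked up, through an explicit sandwich
`X ↦ P X Q` (and the transpose transport of `GF2CertTransport.lean` for three twin orbits), in the table of
deeper orbits. The fourteen codimension-2 orbit bounds of the certificate are HYPOTHESES (each the statement
`Cert 3 3 3 K b`: every bilinear computation over `𝔽₂` of `(X, Y) ↦ X Y` restricted to
`X ∈ S_K = {X : κ(X) = 0, κ ∈ K}` has at least `b` products), so the end theorem
`rankGe20F2_of_codim2Bounds` (file `WangTop333Cert.lean`) is CONDITIONAL; nothing in these files proves `RankGe20F2`.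
Data: `WangTop333Data.lean`; checker: `Summits/MatrixMultiplication/OmegaCensus/SmallFormats/GF2OrbitSweep.lean`
(cell `pub-omega`) with `GF2OrbitSplit.lean`; assembly: `GF2CertTransport.lean` (`sweepJ`).

This file: all 21 orbits of `os` are justified (`okJ_all`: 0–13 hypotheses, 14–16 transposes of 0, 3, 7, 17–20 by
`ok17`–`ok20`), no residual obligations (`obligs_top333`), and the end theorem `rankGe20F2_of_codim2Bounds`.
-/

set_option Elab.async false

namespace Summit.Ventures.MM22.GF2Cert.Top333

open Summit.MatrixMultiplication.OmegaCensus.GF2RankLB Literature.Computability.AlgebraicComplexity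
open Summit.Ventures.MM22.GF2Cert Summit.Ventures.MM22

/-- Every orbit of `os` is justified: 0–13 by hypothesis, 14–16 as transposes of 0, 3, 7, and 17–20 by their own steps. -/
theorem okJ_all : ∀ i < os.length, okJ 3 os hyps trs i = true := by
  intro i hi
  rw [os_length] at hi
  interval_cases i
  · decide +kernel
  · decide +kernel
  · decide +kernel
  · decide +kernel
  · decide +kernel
  · decide +kernel
  · decide +kernel
  · decide +kernel
  · decide +kernel
  · decide +kernel
  · decide +kernel
  · decide +kernel
  · decide +kernel
  · decide +kernel
  · decide +kernel
  · decide +kernel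
  · decide +kernel
  · exact okJ_of_orbitCheck ok17
  · exact okJ_of_orbitCheck ok18
  · exact okJ_of_orbitCheck ok19
  · exact okJ_of_orbitCheck ok20

/-- No orbit of `os` has a forced-product step, so there are no residual obligations. -/
theorem obligs_top333 : ∀ i : ℕ, i < 21 → Obligs 3 3 os i := by
  intro i hi
  interval_cases i
  · exact obligs_of_noForced os 0 (by decide +kernel)
  · exact obligs_of_noForced os 1 (by decide +kernel)
  · exact obligs_of_noForced os 2 (by decide +kernel)
  · exact obligs_of_noForced os 3 (by decide +kernel)
  · exact obligs_of_noForced os 4 (by decide +kernel)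
  · exact obligs_of_noForced os 5 (by decide +kernel)
  · exact obligs_of_noForced os 6 (by decide +kernel)
  · exact obligs_of_noForced os 7 (by decide +kernel)
  · exact obligs_of_noForced os 8 (by decide +kernel)
  · exact obligs_of_noForced os 9 (by decide +kernel)
  · exact obligs_of_noForced os 10 (by decide +kernel)
  · exact obligs_of_noForced os 11 (by decide +kernel)
  · exact obligs_of_noForced os 12 (by decide +kernel)
  · exact obligs_of_noForced os 13 (by decide +kernel)
  · exact obligs_of_noForced os 14 (by decide +kernel)
  · exact obligs_of_noForced os 15 (by decide +kernel)
  · exact obligs_of_noForced os 16 (by decide +kernel)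
  · exact obligs_of_noForced os 17 (by decide +kernel)
  · exact obligs_of_noForced os 18 (by decide +kernel)
  · exact obligs_of_noForced os 19 (by decide +kernel)
  · exact obligs_of_noForced os 20 (by decide +kernel)

/-- **Main theorem (CONDITIONAL).** If the fourteen codimension-2 orbit bounds of Wang's certificate hold —
`Cert 3 3 3 K b`: every bilinear computation over `𝔽₂` of `(X, Y) ↦ X Y` on `S_K × 𝔽₂^{3×3}` has at least `b`
products — then `20 ≤ R_{𝔽₂}(⟨3,3,3⟩)` (`RankGe20F2`). Everything above those fourteen claims (the three
codimension-1 orbits at `19` and the root at `20`: 1,417 DFS leaves of Wang's trace, 1,276 sandwich lookups, three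
transposes) is checked by the kernel. This does NOT prove `RankGe20F2`. -/
theorem rankGe20F2_of_codim2Bounds
    (h0 : Cert 3 3 3 [1, 2] 17)
    (h1 : Cert 3 3 3 [1, 10] 18)
    (h2 : Cert 3 3 3 [1, 16] 18)
    (h3 : Cert 3 3 3 [1, 20] 18)
    (h4 : Cert 3 3 3 [1, 84] 18)
    (h5 : Cert 3 3 3 [1, 160] 18)
    (h6 : Cert 3 3 3 [10, 19] 18)
    (h7 : Cert 3 3 3 [10, 20] 18)
    (h8 : Cert 3 3 3 [10, 68] 18)
    (h9 : Cert 3 3 3 [10, 84] 18)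
    (h10 : Cert 3 3 3 [10, 96] 18)
    (h11 : Cert 3 3 3 [10, 258] 18)
    (h12 : Cert 3 3 3 [10, 275] 18)
    (h13 : Cert 3 3 3 [84, 163] 18) :
    RankGe20F2 := by
  have hh : ∀ e ∈ hyps, Cert 3 3 3 (kOf os e.1) e.2 := by
    intro e he
    simp only [hyps, List.mem_cons, List.not_mem_nil, or_false] at he
    rcases he with rfl | rfl | rfl | rfl | rfl | rfl | rfl | rfl | rfl | rfl | rfl | rfl | rfl | rfl
    exacts [h0, h1, h2, h3, h4, h5, h6, h7, h8, h9, h10, h11, h12, h13]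
  exact le_tensorRank_of_sweepJ (n := 3) os hyps trs okJ_all
    (fun i hi => obligs_top333 i (by rw [os_length] at hi; exact hi)) hh 20 (by rw [os_length]; decide) rfl

end Summit.Ventures.MM22.GF2Cert.Top333
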